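import Literature.AnabelianGeometry.AbsoluteAnabelian.AbsTopIII.Thm19KummerTowerBridge
import Literature.AnabelianGeometry.AbsoluteAnabelian.AbsTopIII.Thm19EvaluationSaturated
import HarnessLib

/-!
# [AbsTopIII] Thm. 1.9 (d)(e) for GEOMETRIC (tagged) directed systems — the statements of record that the
# law tower actually proves (statements only)

Mochizuki, *Topics in Absolute Anabelian Geometry III*, §1, Theorem 1.9 (d)(e), manuscript pp. 37–38 (lit
key `paper:url-5493eb38cbb7`): "`V` ranges over the open subschemes obtained by removing finite
collections of NF-points from `Z ×_{k_Z} k′`" — a system of GEOMETRIC objects and morphisms.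

Sub-DAG `plan/L4/SUBDAG-AbsTopIII-Thm19.md` rows Thm19.d r8–r10 / Thm19.e r11 (cell abc-iut; table writer
abc-iut-w5-d213).  SELF-AUDIT (abc-iut-w5-d213 gen 2, second finding of the day, same class as
F-w5d213-self-1): the statements of record `Thm19d_inj` / `Thm19d_functionField` / `Thm19d_constants` /
`Thm19eSat` (over `IntrinsicKummerModel`) quantify over ALL directed systems
`S : CurveModel.NFComplementSystem`, whose legs `Π_{Z_i} → Π_Z` and transitions `Π_{V_j} → Π_{V_i}` are
BARE homomorphisms of extensions subject only to group-theoretic axioms; at the intended model such a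
system need not be geometric (e.g. legs twisted by inner automorphisms), whereas the closers obtained
from the law tower (`DescentKummerModel.thm19d_of_tags`, `PlacedKummerModel.thm19eSat_of_tags`) need
EVERY system to carry geometric tags (`NFComplementSystem.GeomTags`) — a hypothesis that is false for
exotic systems, so that as closers of the ∀-systems statements they are not known to be non-vacuous at
the model.  What the tower DOES prove, per system and non-vacuously, is Thm. 1.9 (d)(e) for every
GEOMETRIC (tagged) — and, for (e), SATURATED — system.  THIS FILE types exactly those statements, over
`DescentKummerModel` (the lowest layer with the base-change vocabulary of the tags):
`Thm19dTagged` (the three (d)-conclusions for every tagged system) and `Thm19eTagged` (the conclusion of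
`Thm19eSat` for every saturated tagged system); their closers from the named facts alone are
`DescentKummerModel.thm19dTagged_of_facts` / `PlacedKummerModel.thm19eTagged_of_facts` (proof files).
`Thm19d_* → Thm19dTagged`-type implications are immediate.  No new Prop FACT: restatements of the printed
(d)(e) relative to `M` with the printed (geometric) range of "`V`".  HONEST FRAMING: statements-first;
typed ≠ proved; nothing here bears on [IUTchIII] Cor. 3.12.
-/

noncomputable section

open CategoryTheory
open scoped Classical

namespace Literature.AnabelianGeometry.AbsoluteAnabelian.AbsTopIII

open Literature.NumberTheory.DiophantineGeometry
open Literature.NumberTheory.DiophantineGeometry.AlgFunctionField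

universe u

namespace DescentKummerModel

/-- **Thm. 1.9 (d) for GEOMETRIC systems, relative to `N`**: for every directed system of NF-complements
over a (d)-input `Z` that carries geometric tags (its legs and transitions ARE the model's base-change /
open-immersion legs, and it is cofinal): the level Kummer maps into the container are injective
("`↪`"), "`K_{Z_NF}^×`" (`functionFieldPart = nfRationalImage`, the image of an injective homomorphism
from `K_{Z_NF}^×`) and "`k̄_NF^×`" (`constantPart = nfConstantImage`, the image of an injective
homomorphism from `k̄_NF^×`).  (The three ∀-systems statements `Thm19d_inj` / `Thm19d_functionField` /
`Thm19d_constants`, restricted to tagged systems.) [cite: MochizukiAbsTopIII2015, Thm 1.9 (d) p.37] -/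
def Thm19dTagged (N : DescentKummerModel.{u}) : Prop :=
  ∀ (Z : N.Curve), N.IsThm19dInput Z → ∀ (ι : Type u) [Preorder ι] [Nonempty ι] [IsDirectedOrder ι]
    (S : CurveModel.NFComplementSystem N.toCurveModel Z ι)
    (_ : CurveModel.NFComplementSystem.GeomTags N S),
    (∀ i : ι, Function.Injective (N.kummerToContainer S i)) ∧
      (N.functionFieldPart S = N.nfRationalImage S ∧
        ∃ e : Additive (N.NFFunctionField Z)ˣ →+ S.kummerContainer,
          Function.Injective e ∧ Set.range e = N.functionFieldPart S) ∧
      (N.constantPart S = N.nfConstantImage S ∧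
        ∃ e : Additive (↥(N.kbarNF Z))ˣ →+ S.kummerContainer,
          Function.Injective e ∧ Set.range e = N.constantPart S)

/-- **Thm. 1.9 (e) for GEOMETRIC SATURATED systems, relative to `N`**: for every saturated directed system
of NF-complements over a (d)-input `Z` carrying geometric tags, the extracted triple is isomorphic to the
Prop.-1.3 triple of an algebraic function field `K ≅ K_{Z_NF}` of genus `≥ 2` over an algebraically
closed `k ≅ k̄_NF` (the conclusion of `Thm19eSat`, restricted to tagged systems).
[cite: MochizukiAbsTopIII2015, Thm 1.9 (e) p.38] -/
def Thm19eTagged (N : DescentKummerModel.{u}) : Prop :=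
  ∀ (Z : N.Curve), N.IsThm19dInput Z → ∀ (ι : Type u) [Preorder ι] [Nonempty ι] [IsDirectedOrder ι]
    (S : CurveModel.NFComplementSystem N.toCurveModel Z ι), N.IsSaturated S →
    ∀ (_ : CurveModel.NFComplementSystem.GeomTags N S),
    ∃ (k : Type u) (K : Type u) (_ : Field k) (_ : Field K) (_ : Algebra k K),
      IsAlgClosed k ∧ IsAlgFunctionField k K ∧ 2 ≤ genus k K ∧
        Nonempty (K ≃+* N.NFFunctionField Z) ∧ Nonempty (k ≃+* N.kbarNF Z) ∧
          ∃ (φ : (N.evaluationTriple S).G ≃* (valuationEvaluationData k K).G)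
            (σ : (N.evaluationTriple S).I ≃ (valuationEvaluationData k K).I),
            (N.evaluationTriple S).IsIso (valuationEvaluationData k K) φ σ

end DescentKummerModel

end Literature.AnabelianGeometry.AbsoluteAnabelian.AbsTopIII
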